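import Summits.PneNP.PneNP.Theorems.ConvexRankGatesCaptureTJoinDefs
import Mathlib.LinearAlgebra.Matrix.SchurComplement
import Mathlib.LinearAlgebra.Matrix.Block
import Mathlib.Algebra.Ring.GeomSum
import HarnessLib

/-!
# Crux `Capture` (stmt-PneNP-2659) — the T-JOIN door is ONE GRANK gate: the transfer determinant

`det bigN = (−1)^k · det schurM` (`det_bigN`): the transfer matrix `[[1 − E, src], [snk, 0]]` with
`E = layerMat = ((1 + A) ⊗ shift) ⊗ 1_k` has a unipotent top-left block (`E` raises the layer, so `1 − E`
is block upper triangular with identity diagonal blocks: `det (1 − E) = 1`, and `E^{L+1} = 0` gives the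
explicit inverse `Σ_{m ≤ L} E^m`), and its Schur complement `snk (1 − E)⁻¹ src` picks out exactly the
layer-`0`-to-layer-`L` transfer `((1 + A)^L) (τ j) (τ i)` inside copy `j`, weighted by the source weight
`c i j` — the pairing matrix `schurM`. Powers of `E` are computed by the mixed-product rule for Kronecker
products (`layerMat_pow`). [folklore]
-/

namespace Summit.PneNP.PneNP.Theorems.Capture.TJoin

set_option linter.dupNamespace false -- `Summit.PneNP.PneNP.…`: summit = sub-problem (D-0017)

open Matrix Finset
open scoped Kronecker

variable {V : Type} [Fintype V] [DecidableEq V] {n k : ℕ} {R : Type} [CommRing R]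

/-! ### Powers of the shift and of the layered transfer matrix -/

omit [Fintype V] [DecidableEq V] in
/-- Sums over `Fin (L+1)` against the test `(b : ℕ) = m`. [folklore] -/
theorem sum_fin_ite_val_eq (L m : ℕ) (f : Fin (L + 1) → R) :
    (∑ b : Fin (L + 1), if (b : ℕ) = m then f b else 0) =
      if h : m ≤ L then f ⟨m, Nat.lt_succ_of_le h⟩ else 0 := by
  split_ifs with h
  · rw [Finset.sum_eq_single ⟨m, Nat.lt_succ_of_le h⟩]
    · simp
    · intro b _ hb
      rw [if_neg]
      intro hbm
      exact hb (Fin.ext hbm)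
    · intro hb
      exact absurd (Finset.mem_univ _) hb
  · refine Finset.sum_eq_zero fun b _ => ?_
    rw [if_neg]
    intro hbm
    exact h (hbm ▸ Nat.le_of_lt_succ b.isLt)

omit [Fintype V] [DecidableEq V] in
/-- **Powers of the shift**: `(shift^m) a b = 1` iff `b = a + m`. [folklore] -/
theorem shiftMat_pow_apply (L : ℕ) : ∀ (m : ℕ) (a b : Fin (L + 1)),
    ((shiftMat L : Matrix _ _ R) ^ m) a b = if (b : ℕ) = a + m then 1 else 0 := by
  intro m
  induction m with
  | zero =>
      intro a b
      rw [pow_zero, Matrix.one_apply, add_zero]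
      by_cases hab : a = b
      · subst hab; simp
      · rw [if_neg hab, if_neg]
        intro h
        exact hab (Fin.ext h.symm)
  | succ m ih =>
      intro a b
      rw [pow_succ, Matrix.mul_apply]
      have hterm : ∀ z : Fin (L + 1), ((shiftMat L : Matrix _ _ R) ^ m) a z * (shiftMat L : Matrix _ _ R) z b =
          if (z : ℕ) = a + m then (if (b : ℕ) = (a + m) + 1 then 1 else 0) else 0 := fun z => by
        rw [ih, shiftMat_apply]
        by_cases hz : (z : ℕ) = a + m
        · rw [if_pos hz, if_pos hz, one_mul, hz]
        · rw [if_neg hz, if_neg hz, zero_mul]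
      simp only [hterm]
      rw [sum_fin_ite_val_eq]
      by_cases h : a + m ≤ L
      · rw [dif_pos h, add_assoc]
      · rw [dif_neg h, if_neg]
        intro hb
        have := b.isLt
        omega

omit [Fintype V] [DecidableEq V] in
/-- The shift is nilpotent: `shift^(L+1) = 0`. [folklore] -/
theorem shiftMat_pow_succ (L : ℕ) : (shiftMat L : Matrix _ _ R) ^ (L + 1) = 0 := by
  ext a b
  rw [shiftMat_pow_apply, Matrix.zero_apply, if_neg]
  have := b.isLt
  omega

/-- **Powers of the layered transfer matrix** (mixed-product rule):
`E^m = ((1 + A)^m ⊗ shift^m) ⊗ 1`. [folklore] -/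
theorem layerMat_pow (p q : Fin n → V) (w : Fin n → R) (L k : ℕ) : ∀ m : ℕ,
    (layerMat p q w L k) ^ m =
      (((1 + adjW p q w) ^ m) ⊗ₖ ((shiftMat L : Matrix _ _ R) ^ m)) ⊗ₖ (1 : Matrix (Fin k) (Fin k) R) := by
  intro m
  induction m with
  | zero => simp only [pow_zero, Matrix.one_kronecker_one]
  | succ m ih =>
      rw [pow_succ, ih, layerMat, ← Matrix.mul_kronecker_mul, ← Matrix.mul_kronecker_mul, Matrix.one_mul,
        ← pow_succ, ← pow_succ]

/-- Entries of the powers of the layered transfer matrix. [folklore] -/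
theorem layerMat_pow_apply (p q : Fin n → V) (w : Fin n → R) (L k m : ℕ) (u u' : V) (a b : Fin (L + 1))
    (j j' : Fin k) :
    ((layerMat p q w L k) ^ m) ((u, a), j) ((u', b), j') =
      if j = j' ∧ (b : ℕ) = a + m then ((1 + adjW p q w) ^ m) u u' else 0 := by
  rw [layerMat_pow, Matrix.kronecker_apply, Matrix.kronecker_apply, shiftMat_pow_apply, Matrix.one_apply]
  by_cases hj : j = j'
  · by_cases hb : (b : ℕ) = a + m
    · simp [hj, hb]
    · simp [hj, hb]
  · simp [hj]

/-- The layered transfer matrix is nilpotent: `E^(L+1) = 0`. [folklore] -/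
theorem layerMat_pow_succ (p q : Fin n → V) (w : Fin n → R) (L k : ℕ) :
    (layerMat p q w L k) ^ (L + 1) = 0 := by
  rw [layerMat_pow, shiftMat_pow_succ, Matrix.kronecker_zero, Matrix.zero_kronecker]

/-- **Explicit inverse of the unipotent block**: `(1 − E) · Σ_{m ≤ L} E^m = 1`. [folklore] -/
theorem one_sub_layerMat_mul_geom (p q : Fin n → V) (w : Fin n → R) (L k : ℕ) :
    (1 - layerMat p q w L k) * (∑ m ∈ Finset.range (L + 1), (layerMat p q w L k) ^ m) = 1 := by
  rw [mul_neg_geom_sum, layerMat_pow_succ, sub_zero]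

/-! ### The unipotent block has determinant one -/

/-- `1 − E` is block upper triangular with respect to the layer. [folklore] -/
theorem blockTriangular_one_sub_layerMat (p q : Fin n → V) (w : Fin n → R) (L k : ℕ) :
    (1 - layerMat p q w L k).BlockTriangular fun r => r.1.2 := by
  rintro ⟨⟨u, a⟩, j⟩ ⟨⟨u', b⟩, j'⟩ hlt
  change b < a at hlt
  have hne : ((u, a), j) ≠ ((u', b), j') := by
    intro h
    simp only [Prod.mk.injEq] at h
    exact hlt.ne' (h.1.2)
  rw [Matrix.sub_apply, Matrix.one_apply, if_neg hne, zero_sub, neg_eq_zero, ← pow_one (layerMat p q w L k),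
    layerMat_pow_apply, if_neg]
  rintro ⟨-, hb⟩
  have : (b : ℕ) < a := hlt
  omega

/-- The diagonal blocks of `1 − E` (fixed layer) are identities. [folklore] -/
theorem toSquareBlock_one_sub_layerMat (p q : Fin n → V) (w : Fin n → R) (L k : ℕ) (ℓ : Fin (L + 1)) :
    (1 - layerMat p q w L k).toSquareBlock (fun r => r.1.2) ℓ = 1 := by
  ext ⟨⟨⟨u, a⟩, j⟩, ha⟩ ⟨⟨⟨u', b⟩, j'⟩, hb⟩
  change a = ℓ at ha
  change b = ℓ at hb
  rw [Matrix.toSquareBlock_def, Matrix.of_apply, Matrix.sub_apply, ← pow_one (layerMat p q w L k),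
    layerMat_pow_apply, Matrix.one_apply, Matrix.one_apply]
  have hS : ¬ (j = j' ∧ (b : ℕ) = a + 1) := by
    rintro ⟨-, h⟩
    rw [ha, hb] at h
    omega
  rw [if_neg hS, sub_zero]
  simp only [Subtype.mk.injEq]

/-- **`det (1 − E) = 1`.** [folklore] -/
theorem det_one_sub_layerMat (p q : Fin n → V) (w : Fin n → R) (L k : ℕ) :
    (1 - layerMat p q w L k).det = 1 := by
  rw [(blockTriangular_one_sub_layerMat p q w L k).det]
  refine Finset.prod_eq_one fun ℓ _ => ?_
  rw [toSquareBlock_one_sub_layerMat, Matrix.det_one]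

/-! ### The Schur complement is the pairing matrix -/

/-- The sink row `j` of any product starts at `((τ j, 0), j)`. [folklore] -/
theorem snkMat_mul_apply (τ : Fin k → V) (L : ℕ) (X : Matrix ((V × Fin (L + 1)) × Fin k) ((V × Fin (L + 1)) × Fin k) R)
    (j : Fin k) (r' : (V × Fin (L + 1)) × Fin k) :
    ((snkMat τ L : Matrix (Fin k) ((V × Fin (L + 1)) × Fin k) R) * X) j r' = X ((τ j, 0), j) r' := by
  rw [Matrix.mul_apply]
  simp only [snkMat_apply, ite_mul, one_mul, zero_mul]
  rw [Finset.sum_ite_eq']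
  simp

/-- **The Schur complement of the transfer matrix is the pairing matrix**:
`snk · (Σ_{m ≤ L} E^m) · src = schurM`. [folklore] -/
theorem snkMat_mul_geom_mul_srcMat (p q : Fin n → V) (τ : Fin k → V) (w : Fin n → R)
    (c : Fin k → Fin k → R) (L : ℕ) :
    (snkMat τ L : Matrix (Fin k) ((V × Fin (L + 1)) × Fin k) R) *
        (∑ m ∈ Finset.range (L + 1), (layerMat p q w L k) ^ m) * srcMat τ c L =
      schurM p q τ w c L := by
  ext j i
  rw [Matrix.mul_apply, schurM_apply]
  simp only [snkMat_mul_apply, Matrix.sum_apply, srcMat_apply]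
  -- the sum over `r' = ((u', b), j')`
  rw [Fintype.sum_prod_type, Fintype.sum_prod_type]
  simp only [layerMat_pow_apply, Fin.val_zero, zero_add, mul_ite, mul_zero]
  -- only `u' = τ i`, `b = L`, `j' = j`, `m = L` survive
  have hinner : ∀ (u' : V) (b : Fin (L + 1)),
      (∑ j' : Fin k, if u' = τ i ∧ (b : ℕ) = L then
        (∑ m ∈ Finset.range (L + 1), if j = j' ∧ (b : ℕ) = m then ((1 + adjW p q w) ^ m) (τ j) u' else 0) *
          c i j' else 0) =
      if u' = τ i ∧ (b : ℕ) = L then ((1 + adjW p q w) ^ L) (τ j) u' * c i j else 0 := by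
    intro u' b
    by_cases hub : u' = τ i ∧ (b : ℕ) = L
    · simp only [if_pos hub]
      have hm : ∀ j' : Fin k, (∑ m ∈ Finset.range (L + 1),
          if j = j' ∧ (b : ℕ) = m then ((1 + adjW p q w) ^ m) (τ j) u' else 0) =
            if j = j' then ((1 + adjW p q w) ^ L) (τ j) u' else 0 := fun j' => by
        rw [hub.2]
        by_cases hjj : j = j'
        · simp only [hjj, true_and, if_true]
          rw [Finset.sum_ite_eq (Finset.range (L + 1)) L (fun m => ((1 + adjW p q w) ^ m) (τ j') u'),
            if_pos (Finset.self_mem_range_succ L)]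
        · simp [hjj]
      simp only [hm, ite_mul, zero_mul]
      rw [Finset.sum_ite_eq]
      simp
    · simp only [if_neg hub, Finset.sum_const_zero]
  simp only [hinner]
  -- now the sum over `u'` and `b`
  have hb : ∀ u' : V, (∑ b : Fin (L + 1), if u' = τ i ∧ (b : ℕ) = L then
      ((1 + adjW p q w) ^ L) (τ j) u' * c i j else 0) =
        if u' = τ i then ((1 + adjW p q w) ^ L) (τ j) u' * c i j else 0 := fun u' => by
    by_cases hu : u' = τ i
    · simp only [hu, true_and, if_true]
      rw [sum_fin_ite_val_eq, dif_pos le_rfl]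
    · simp [hu]
  simp only [hb]
  rw [Finset.sum_ite_eq']
  simp [mul_comm]

/-- **The transfer determinant**: `det bigN = (−1)^k · det schurM`. [folklore] -/
theorem det_bigN : ∀ {V : Type} [Fintype V] [DecidableEq V] {n k : ℕ} {R : Type} [CommRing R]
    (p q : Fin n → V) (τ : Fin k → V) (w : Fin n → R) (c : Fin k → Fin k → R) (L : ℕ),
    (bigN p q τ w c L).det = (-1) ^ k * (schurM p q τ w c L).det := by
  intro V _ _ n k R _ p q τ w c L
  letI : Invertible (1 - layerMat p q w L k) :=
    invertibleOfRightInverse _ _ (one_sub_layerMat_mul_geom p q w L k)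
  have hinv : ⅟(1 - layerMat p q w L k) = ∑ m ∈ Finset.range (L + 1), (layerMat p q w L k) ^ m := rfl
  rw [bigN, Matrix.det_fromBlocks₁₁, det_one_sub_layerMat, one_mul, hinv, snkMat_mul_geom_mul_srcMat,
    zero_sub, Matrix.det_neg, Fintype.card_fin]

end Summit.PneNP.PneNP.Theorems.Capture.TJoin
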